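import Summits.NavierStokesRegularity.FluidComputer.PalasekTowerRegisterGlobal
import Summits.NavierStokesRegularity.FluidComputer.PalasekTowerSilentTail
import Summits.NavierStokesRegularity.FluidComputer.PalasekTowerStageUniqueness
import Summits.NavierStokesRegularity.FluidComputer.PalasekTowerDepthAssembly

/-!
# The items of record (REGISTER v2.3′) assert an unforced loss of smoothness; their rung ladder

Cell `ns-blowup`, seat `ns-blowup-ecbridge-1` (g2); companion of `PalasekTowerRegisterGlobal.lean`
(p411629, REGISTER v2.3′: `Schedule.Quiet` — the force VANISHES from `τ 1` on, by registration —,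
`Schedule.AnchorGlobal`, `Margins.routeG`, the items of record `EpisodeBaseG` / `EpisodeInductionG`
at `ν = 1`, `TowerRates.wide`, `Λ = 8`, `θ = 6/5`), `PalasekTowerSilentTail.lean` (p408508:
`Realisation.unforced_blowup_after`) and `PalasekTowerDepthAssembly.lean` (p409326:
`Margins.LevelMonotone`). LABEL: E-C typing; WHAT THIS IS NOT: not Navier–Stokes evidence — one-line
consequences of landed declarations; no stage, tower or instance is constructed or claimed.

* §1 `unforced_blowup_of_episodesG`: with the register's `Quiet` clause the silent tail is no longer
  a re-forcing argument (`PalasekTowerReforce`) but a FIELD — K1G ∧ K2G yield a realisation whose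
  force is `S.f`, identically `0` from `τ 1 < T`; by `Realisation.unforced_blowup_after` it is, from
  `τ 1` on, a classical solution of the UNFORCED system from a `C^∞`, divergence-free, finite-energy
  state with no classical unforced continuation past `T` (the route's declared physics bet «autonomous
  heredity», planner ADDENDUM l.1015 (1), in the tree's continuation vocabulary, BY NAME for the
  v2.3′ items).
* §2 The v2.3′ RUNG LADDER `RungG K` (pinned, rigid, quiet schedule with a `routeG` stage at level
  `K`): `rungG_one_iff : RungG 1 ↔ EpisodeBaseG`, `RungG.mono` (`Stage.restrictOfAntitone`,
  `Margins.antitone_routeG`), `RungG.episodeBaseG`, `rungG_of_episodesG` — `RungG 2` is the BC5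
  plan-only rung of the route of record (first hand-over, one level below K2G's range).
* §3 Bookkeeping: `Margins.Antitone` (PalasekTowerStageUniqueness) and `Margins.LevelMonotone`
  (PalasekTowerDepthAssembly) are the same predicate (`Margins.antitone_iff_levelMonotone`), so the
  SHAPE-E ladder lemmas apply to `routeG` (`Margins.levelMonotone_routeG`).

References: S. Palasek, arXiv:2605.13827 §4, Rem. 1.4 [cite: Palasek2026ElementaryModel, §4];
J. T. Beale, T. Kato, A. Majda, Comm. Math. Phys. 94 (1984) §1 [cite: BealeKatoMajda1984, §1].
-/

noncomputable section

namespace Summit.NavierStokesRegularity.FluidComputer.PalasekTowerClayBridge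

open Set MeasureTheory Filter Topology Function
open scoped ENNReal ContDiff NNReal
open Literature.Analysis.FluidPDE

/-! ## §1 The v2.3′ items assert an unforced loss of smoothness after `τ 1` -/

/-- **K1G ∧ K2G ⇒ a realisation whose force is silent from `τ 1`** (the register's `Quiet` clause,
carried by the glued realisation, whose force IS the schedule's). [folklore] -/
theorem realisation_silent_of_episodesG (h₁ : EpisodeBaseG) (h₂ : EpisodeInductionG) :
    ∃ W : Realisation 1 TowerRates.wide, ∃ b, 0 ≤ b ∧ b < W.T ∧ ∀ t, b ≤ t → ∀ x, W.f t x = 0 := by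
  obtain ⟨S, hP, hR, hQ, ⟨s₁⟩⟩ := h₁
  refine ⟨Realisation.ofEpisodes S s₁ (fun n s => h₂ S hP hR hQ (n + 1) (by omega) s), S.τ 1,
    (S.τ_pos 1).le, S.τ_lt_T 1, fun t ht x => ?_⟩
  exact hQ.apply ht x

/-- **The items of record (v2.3′) assert an UNFORCED finite-time loss of smoothness**: from
`EpisodeBaseG ∧ EpisodeInductionG`, a realisation `W` on the wide-base rates at unit viscosity and a
time `b = τ 1 ∈ [0, T)` such that `(W.u, W.p)` solves the UNFORCED system classically on `[b, T)`, the
state `W.u b` is `C^∞`, divergence free and of finite energy (no rapid decay claimed — not a Clay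
datum), and no classical unforced solution on any `[b, T')`, `T' > T`, continues it
(`Realisation.unforced_blowup_after`). [cite: Palasek2026ElementaryModel, §4 and Rem. 1.4] -/
theorem unforced_blowup_of_episodesG (h₁ : EpisodeBaseG) (h₂ : EpisodeInductionG) :
    ∃ W : Realisation 1 TowerRates.wide, ∃ b, 0 ≤ b ∧ b < W.T ∧
      IsClassicalNSSolutionOn (Ico b W.T) 1 0 W.u W.p ∧
      ContDiff ℝ ∞ (W.u b) ∧ NSWave0.IsDivFree (W.u b) ∧
      (∃ C : ℝ≥0∞, C < ⊤ ∧ ∫⁻ x, ‖W.u b x‖ₑ ^ 2 ≤ C) ∧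
      ∀ T', W.T < T' →
        ¬ ∃ (u' : ℝ → EuclideanSpace ℝ (Fin 3) → EuclideanSpace ℝ (Fin 3))
            (p' : ℝ → EuclideanSpace ℝ (Fin 3) → ℝ),
            IsClassicalNSSolutionOn (Ico b T') 1 0 u' p' ∧ ∀ t ∈ Ico b W.T, u' t = W.u t := by
  obtain ⟨W, b, hb0, hbT, hW⟩ := realisation_silent_of_episodesG h₁ h₂
  exact ⟨W, b, hb0, hbT, W.unforced_blowup_after hb0 hbT hW⟩

/-! ## §2 The v2.3′ rung ladder -/

/-- **Rung `K` of the v2.3′ register**: some pinned (`Λ = 8`, `θ = 6/5`), rigid, quiet schedule on the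
wide-base rates admits a globally anchored strained cored stage at level `K`, at unit viscosity
(open for every `K ≥ 1`; never asserted). `RungG 1` is `EpisodeBaseG`; `RungG 2` is the route's BC5
plan-only rung (the first hand-over, one level below K2G's range). [cite: Palasek2026ElementaryModel, §4] -/
@[conjecture] def RungG (K : ℕ) : Prop :=
  ∃ S : Schedule TowerRates.wide, S.Pins 8 (6 / 5) ∧ S.Rigid ∧ S.Quiet ∧
    Nonempty (Stage 1 TowerRates.wide S (Margins.routeG TowerRates.wide) K)

/-- The first rung is K1G of record, verbatim. [folklore] -/
theorem rungG_one_iff : RungG 1 ↔ EpisodeBaseG := Iff.rfl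

/-- The rungs form a ladder (the v2.3′ route margin is antitone in the level). [folklore] -/
theorem RungG.mono {K K' : ℕ} (hK : K ≤ K') (h : RungG K') : RungG K := by
  obtain ⟨S, hP, hR, hQ, ⟨s⟩⟩ := h
  exact ⟨S, hP, hR, hQ, ⟨s.restrictOfAntitone (Margins.antitone_routeG TowerRates.wide) hK⟩⟩

/-- Every rung `K ≥ 1` is a K1G witness. [folklore] -/
theorem RungG.episodeBaseG {K : ℕ} (hK : 1 ≤ K) (h : RungG K) : EpisodeBaseG :=
  rungG_one_iff.1 (h.mono hK)

/-- The items of record give every rung (iterate K2G from the K1G stage, `Assembly.chain`). [folklore] -/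
theorem rungG_of_episodesG (h₁ : EpisodeBaseG) (h₂ : EpisodeInductionG) (K : ℕ) : RungG (K + 1) := by
  obtain ⟨S, hP, hR, hQ, ⟨s₁⟩⟩ := h₁
  have step : ∀ n, ∀ s : Stage 1 TowerRates.wide S (Margins.routeG TowerRates.wide) (n + 1),
      ∃ s' : Stage 1 TowerRates.wide S (Margins.routeG TowerRates.wide) (n + 1 + 1), s.Extends s' :=
    fun n s => h₂ S hP hR hQ (n + 1) (Nat.succ_pos n) s
  exact ⟨S, hP, hR, hQ, ⟨Assembly.chain s₁ step K⟩⟩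

/-! ## §3 Bookkeeping: the two names of level-monotonicity agree -/

/-- `Margins.Antitone` (PalasekTowerStageUniqueness) and `Margins.LevelMonotone`
(PalasekTowerDepthAssembly) are the same predicate. [folklore] -/
theorem Margins.antitone_iff_levelMonotone {R : TowerRates} (m : Margins R) :
    m.Antitone ↔ m.LevelMonotone :=
  Iff.rfl

/-- The v2.3′ route margin is level-monotone (so `DepthTower.mono_of_levelMonotone`,
`PinnedDepth.mono` and the SHAPE-E ladder lemmas apply to it). [folklore] -/
theorem Margins.levelMonotone_routeG (R : TowerRates) : (Margins.routeG R).LevelMonotone :=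
  (Margins.antitone_iff_levelMonotone _).1 (Margins.antitone_routeG R)

end Summit.NavierStokesRegularity.FluidComputer.PalasekTowerClayBridge

end
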